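import Mathlib
import Summits.HodgeConjecture.HodgeConjecture.Theorems.SoloBlindZippel

/-!
# SoloBlindNoQuadric — finite certificate for THEOREM NQ (solo-blind s102)

Kernel certificate for the finite / arithmetical core of THEOREM NQ of the solo-blind memo
`work/s102/no-quadrics.md`: *no irreducible quadric surface on the sextic Dwork fourfold*
`X_ψ : Σ xᵢ⁶ + ψ·x₁⋯x₆ = 0` *can carry the invariant Hodge line* (at `ψ = 10`, conditional on the memo's
HODGE-LINE numerics exactly as COR NP10), so a carrier has degree `≥ 3`.

The argument (prose in the memo): for a quadric `Q ⊂ X_ψ` with span `Λ = ℙ³` and `W = Λ^⊥ ⊂ ℂ⁶` (a 2-plane),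
`Σ_{g ∈ G} [Q]·[gQ]` over the diagonal group `G = ker(∏ : μ₆⁶ → μ₆)/μ₆` (order `1296`) is at most
`34·n₀ + 4·n₂ + 2·n₁`, where `n₀ = #Stab_G(W)`, `n₀ + n₂ = #{g : W ∩ gW ≠ 0}`, `n₁` the rest (Fulton excess
intersection: `Q·Q = c₂(N) = 34`; `Q·gQ = 4 − 5m ≤ 4` when `Λ ∩ gΛ` is a plane; `≤ 2` when it is a line),
while a carrier of degree `2` needs `Σ_g [Q]·[gQ] = 216·2² + 1026·c'²` with `c'` even and non-zero, i.e.
`≥ 4968`, i.e. `32·n₀ + 2·n₂ ≥ 2376`.  The classification of `W` kills this: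
* `W ⊂ ⟨eᵢ,eⱼ,e_k⟩` (graph of non-zero Plücker coordinates a triangle): `X_ψ ∩ Λ` is irreducible — no quadric;
* `W = ⟨eᵢ + c eⱼ, e_k + c' e_l⟩` (two disjoint pairs): `n₀ = 36`, `n₀ + n₂ = 396` (`g_i = g_j ∨ g_k = g_l`),
  `32·36 + 2·360 = 1872 < 2376`;
* otherwise some `4 × 4` minor `D_J(g)` of `[u; v; g·u; g·v]` is a NON-ZERO multilinear polynomial in four of
  the coordinates of `g`, so by the product-form Zippel bound (`SoloBlindZippel.zippel_uniform`) it has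
  `≥ 5⁴ = 625` non-zeros on `μ₆⁴`, whence `n₀ + n₂ ≤ 1296 − 625 = 671`, and `n₀ ≤ 6`; `30·6 + 2·671 < 2376`.

Certified here: the Zippel instance and the complement count `≤ 671` (`meet_zero_count`); the counts
`216 / 36 / 396` in `G` for every pair / every two disjoint pairs of coordinates and the stabiliser-type
counts `36, 6, 1, 1, 36, 6, 3, 2` (`gCounts_holds`, by `decide` on an explicit enumeration of `G`); the graph
lemma core "three pairwise-meeting pairs form a star or a triangle" (`triCheck_holds`); the Chern-class
identities behind `Q·Q = 34`, `T·T = 39` and the Segre bookkeeping `Q·gQ = 4 − 5m`, `T·gT = 9 − 5m`; and the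
inequality chain (`nq_arithmetic`).  NOT certified (prose in the memo): the excess-intersection inputs
(Fulton, Intersection Theory, Prop. 6.1(a), 8.2(b), 14.1), the identification of the cases, the
irreducibility of `S t⁶ + x⁶ + y⁶ + z⁶ + c t³xyz`, and the SCREEN identity `Σ_g[S]·[gS] = 216d² + 1296·Q(π_W[S])`.
-/

set_option linter.dupNamespace false

namespace Summit.HodgeConjecture.HodgeConjecture.Theorems

namespace SoloBlindNoQuadric

open Fin Finset Fintype MvPolynomial

variable {R : Type*} [CommRing R] [IsDomain R] [DecidableEq R]

/-- LEMMA MEET, Zippel instance: a non-zero polynomial in four variables with all individual degrees `≤ 1`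
is non-zero at `≥ 5⁴ = 625` points of `S⁴` when `#S = 6` (the sixth roots of unity in the memo). -/
theorem zippel_six_one_four (p : MvPolynomial (Fin 4) R) (hp : p ≠ 0) (S : Finset R) (hS : S.card = 6)
    (hd : ∀ i, p.degreeOf i ≤ 1) :
    625 ≤ ((piFinset fun _ : Fin 4 => S).filter fun x => ¬ eval x p = 0).card := by
  have h := SoloBlindZippel.zippel_uniform p hp S 1 hd
  rw [hS] at h
  exact h

/-- LEMMA MEET, complement form: such a polynomial VANISHES at `≤ 6⁴ − 5⁴ = 671` points of `S⁴`
(`#{g ∈ G : W ∩ gW ≠ 0} ≤ 671` in the memo, after the fibre count `ker(∏) → μ₆⁴`). -/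
theorem meet_zero_count (p : MvPolynomial (Fin 4) R) (hp : p ≠ 0) (S : Finset R) (hS : S.card = 6)
    (hd : ∀ i, p.degreeOf i ≤ 1) :
    ((piFinset fun _ : Fin 4 => S).filter fun x => eval x p = 0).card ≤ 671 := by
  have h625 := zippel_six_one_four p hp S hS hd
  have htot : (piFinset fun _ : Fin 4 => S).card = 1296 := by
    rw [Fintype.card_piFinset, Finset.prod_const, Finset.card_univ, Fintype.card_fin, hS]; norm_num
  have h2 := Finset.card_filter_add_card_filter_not
    (s := piFinset fun _ : Fin 4 => S) (fun x => eval x p = 0)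
  omega

/-! ## The diagonal group `G = ker(∏ : (ℤ/6)⁶ → ℤ/6)/(diagonal ℤ/6)`, enumerated -/

/-- Number of elements of `G = ker(Σ : (ℤ/6)⁶ → ℤ/6)/(diagonal)` satisfying a Boolean test; the `1296`
elements are enumerated additively, normalised to first coordinate `0`: `(0, k₁, k₂, k₃, k₄, −(k₁+k₂+k₃+k₄)) mod 6`,
as NESTED sums over `List.range 6` (kernel-friendly: no long flat list). -/
def countG (P : List ℕ → Bool) : ℕ :=
  ((List.range 6).map fun k1 => ((List.range 6).map fun k2 => ((List.range 6).map fun k3 =>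
    ((List.range 6).map fun k4 =>
      if P [0, k1, k2, k3, k4, (24 - (k1 + k2 + k3 + k4)) % 6] then 1 else 0).sum).sum).sum).sum

/-- Coordinate `i` of an element of `G` (as a list of residues). -/
def coord (a : List ℕ) (i : ℕ) : ℕ := a.getD i 0

/-- The fifteen 2-subsets of `{0,…,5}` as increasing pairs. -/
def pairs15 : List (ℕ × ℕ) :=
  ((List.range 6).flatMap fun i => (List.range 6).map fun j => (i, j)).filter fun p => p.1 < p.2

/-- Two pairs are disjoint. -/
def disjointPairs (p q : ℕ × ℕ) : Bool := p.1 != q.1 && p.1 != q.2 && p.2 != q.1 && p.2 != q.2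

/-- `g` is constant on the list of coordinates `B`. -/
def constOn (a : List ℕ) (B : List ℕ) : Bool := B.all fun i => B.all fun j => coord a i == coord a j

/-- All `k`-subsets of `{0,…,5}` as increasing lists (for `k = 3, 4, 5`). -/
def subsetsOfSize (k : ℕ) : List (List ℕ) :=
  ((List.range 64).map fun m => (List.range 6).filter fun i => Nat.testBit m i).filter fun B => B.length == k

/-- The counting facts about `G` used in THEOREM NQ: `#G = 1296`; the enumeration is closed under negation and
really lies in `ker(Σ)`; for EVERY pair `{i,j}`: `#{g_i = g_j} = 216`; for EVERY two disjoint pairs: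
`#{g_i = g_j ∧ g_k = g_l} = 36` (the stabiliser of `W = ⟨eᵢ + c eⱼ, e_k + c' e_l⟩`) and
`#{g_i = g_j ∨ g_k = g_l} = 396` (its meeting set); stabiliser types of LEMMA STAB: `#{g constant on B}` is
`36, 6, 1` for EVERY `B` of size `3, 4, 5` and `1` for `B = {0..5}`; two-block types `(2,3) ↦ 6`, `(3,3) ↦ 3`,
`(2,4) ↦ 2` on representatives. -/
def gCounts : Bool :=
  countG (fun _ => true) == 1296 &&
  countG (fun a => ((List.range 6).map (coord a)).sum % 6 != 0) == 0 &&
  pairs15.all (fun p => countG (fun a => coord a p.1 == coord a p.2) == 216) &&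
  pairs15.all (fun p => pairs15.all (fun q => !(disjointPairs p q) ||
    (countG (fun a => coord a p.1 == coord a p.2 && coord a q.1 == coord a q.2) == 36 &&
     countG (fun a => coord a p.1 == coord a p.2 || coord a q.1 == coord a q.2) == 396))) &&
  (subsetsOfSize 3).length == 20 && (subsetsOfSize 4).length == 15 && (subsetsOfSize 5).length == 6 &&
  (subsetsOfSize 3).all (fun B => countG (fun a => constOn a B) == 36) &&
  (subsetsOfSize 4).all (fun B => countG (fun a => constOn a B) == 6) &&
  (subsetsOfSize 5).all (fun B => countG (fun a => constOn a B) == 1) &&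
  countG (fun a => constOn a [0, 1, 2, 3, 4, 5]) == 1 &&
  countG (fun a => constOn a [0, 1] && constOn a [2, 3, 4]) == 6 &&
  countG (fun a => constOn a [1, 2] && constOn a [3, 4, 5]) == 6 &&
  countG (fun a => constOn a [0, 1, 2] && constOn a [3, 4, 5]) == 3 &&
  countG (fun a => constOn a [0, 1] && constOn a [2, 3, 4, 5]) == 2 &&
  countG (fun a => constOn a [1, 2] && constOn a [0, 3, 4, 5]) == 2

set_option maxRecDepth 4000 in
set_option maxHeartbeats 8000000 in
/-- All the counts of `gCounts` hold. -/
theorem gCounts_holds : gCounts = true := by decide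

/-! ## The graph lemma behind LEMMA MEET -/

/-- Two pairs meet. -/
def meets (p q : ℕ × ℕ) : Bool := p.1 == q.1 || p.1 == q.2 || p.2 == q.1 || p.2 == q.2

/-- Three pairs have a common vertex (a star). -/
def isStar (p q r : ℕ × ℕ) : Bool :=
  [p.1, p.2].any fun x => (x == q.1 || x == q.2) && (x == r.1 || x == r.2)

/-- Three pairs span exactly three vertices (a triangle, or degenerate coincidences inside one). -/
def inTriangle (p q r : ℕ × ℕ) : Bool :=
  ((List.range 6).filter fun x => [p.1, p.2, q.1, q.2, r.1, r.2].any fun y => y == x).length == 3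

/-- LEMMA TRI (finite core of "a pairwise-intersecting edge set is a star or a triangle"): any three
pairwise-meeting 2-subsets of `{0,…,5}` have a common point or span exactly three points. -/
def triCheck : Bool :=
  pairs15.length == 15 &&
  pairs15.all fun p => pairs15.all fun q => pairs15.all fun r =>
    !(meets p q && meets p r && meets q r) || isStar p q r || inTriangle p q r

set_option maxHeartbeats 4000000 in
/-- LEMMA TRI holds. -/
theorem triCheck_holds : triCheck = true := by decide

/-! ## Chern / Segre bookkeeping and the inequality chain -/

/-- `c(N_{Q/X}) = (1+h)²(1+2h)/(1+6h) ≡ 1 − 2h + 17h² (mod h³)` for a `(1,1,2)` complete-intersection surface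
in a sextic fourfold (`Q·Q = 17·2 = 34`), and `(1+h)²(1+3h)/(1+6h) ≡ 1 − h + 13h²` for `(1,1,3)` (`T·T = 39`);
planes: `(1+h)³/(1+6h) ≡ 1 − 3h + 21h²` (`P·P = 21`, as in THEOREM NP). -/
theorem chern_identities (h : ℤ) :
    (1 + h) ^ 2 * (1 + 2 * h) - (1 + 6 * h) * (1 - 2 * h + 17 * h ^ 2) = -100 * h ^ 3 ∧
    (1 + h) ^ 2 * (1 + 3 * h) - (1 + 6 * h) * (1 - h + 13 * h ^ 2) = -75 * h ^ 3 ∧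
    (1 + h) ^ 3 - (1 + 6 * h) * (1 - 3 * h + 21 * h ^ 2) = -125 * h ^ 3 ∧
    (17 * 2 = 34 ∧ 13 * 3 = 39 ∧ 21 * 1 = 21) := by
  refine ⟨by ring, by ring, by ring, by norm_num⟩

/-- Segre bookkeeping of the plane case: with `σ₁, σ₀` the degrees of the Segre class of `Z = Q ∩ gQ` in `gQ`,
the localized top Chern class of `O(1) ⊕ O(2)` gives `σ₀ + 3σ₁ = 4`, and then
`Q·gQ = c₁(N_{Q/X})·σ₁ + σ₀ = −2σ₁ + σ₀ = 4 − 5σ₁`; cubic surfaces: `σ₀ + 4σ₁ = 9 ⇒ −σ₁ + σ₀ = 9 − 5σ₁`;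
line case `O(1)²`: `σ₀ + 2σ₁ = 2, σ₁ = 1 ⇒ −2σ₁ + σ₀ = −2` (quadrics), `σ₀ + 2σ₁ = 3 ⇒ −σ₁ + σ₀ = 0` (cubics);
same `ℙ³`: `σ₁ = 4, σ₀ = −8 ⇒ −16` and `34 − 16 − 16 = 2 = H²·Q`. -/
theorem segre_bookkeeping :
    (∀ s0 s1 : ℤ, s0 + 3 * s1 = 4 → -2 * s1 + s0 = 4 - 5 * s1) ∧
    (∀ s0 s1 : ℤ, s0 + 4 * s1 = 9 → -1 * s1 + s0 = 9 - 5 * s1) ∧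
    (∀ s0 : ℤ, s0 + 2 * 1 = 2 → -2 * 1 + s0 = -2) ∧ (∀ s0 : ℤ, s0 + 2 * 1 = 3 → -1 * 1 + s0 = 0) ∧
    ((-2 : ℤ) * 4 + (-8) = -16 ∧ (34 : ℤ) - 16 - 16 = 2) ∧
    (∀ m : ℤ, 0 ≤ m → (4 : ℤ) - 5 * m ≤ 4) := by
  refine ⟨fun s0 s1 h => by omega, fun s0 s1 h => by omega, fun s0 h => by omega, fun s0 h => by omega,
    by norm_num, fun m hm => by omega⟩

/-- The inequality chain of THEOREM NQ / COR NQ10.  SCREEN threshold for degree `2`, `c'` even `≠ 0`: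
`216·4 + 1026·4 = 4968`, i.e. `32n₀ + 2n₂ ≥ 4968 − 2·1296 = 2376`; type (β): `32·36 + 2·(396 − 36) = 1872 < 2376`;
general type: `n₀ ≤ 6`, `n₀ + n₂ ≤ 671`: `30·6 + 2·671 = 1522 < 2376`; unconditional norm bound
`Σ_g Q·gQ ≤ max(34·36 + 4·360 + 2·900, 2592 + 30·6 + 2·671) = 4464`, `Q(v) ≤ (4464 − 864)/1296 = 25/9 < 4·19/24`
(and `< 4ε` at the other two RM points, `ε = 193/6, 1075/162`); cubic surfaces are NOT excluded:
`216·9 + 1026 = 2970 ≤ 36·0 + 6·0 + 3·1296 = 3888`. -/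
theorem nq_arithmetic :
    6 ^ 4 - 5 ^ 4 = 671 ∧ 216 * 4 + 1026 * 4 = 4968 ∧ 4968 - 2 * 1296 = 2376 ∧
    32 * 36 + 2 * (396 - 36) = 1872 ∧ 1872 < 2376 ∧ 30 * 6 + 2 * 671 = 1522 ∧ 1522 < 2376 ∧
    34 * 36 + 4 * 360 + 2 * 900 = 4464 ∧ 2 * 1296 + 30 * 6 + 2 * 671 = 4114 ∧ 4114 ≤ 4464 ∧
    ((4464 : ℚ) - 864) / 1296 = 25 / 9 ∧ (25 : ℚ) / 9 < 4 * (19 / 24) ∧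
    (25 : ℚ) / 9 < 4 * (193 / 6) ∧ (25 : ℚ) / 9 < 4 * (1075 / 162) ∧
    216 * 9 + 1026 = 2970 ∧ 2970 ≤ 3 * 1296 := by
  norm_num

end SoloBlindNoQuadric

end Summit.HodgeConjecture.HodgeConjecture.Theorems
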